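import Literature.Computability.QuantumAlgorithms.CliffordTwistedConvolution
import Mathlib.LinearAlgebra.Matrix.ToLin
import Mathlib.LinearAlgebra.Matrix.Trace
import Mathlib.LinearAlgebra.Matrix.ConjTranspose
import Mathlib.Algebra.Star.Unitary
import Mathlib.LinearAlgebra.UnitaryGroup
import Mathlib.Algebra.Star.BigOperators
import Mathlib.Algebra.CharP.Invertible
import Mathlib.Analysis.Complex.Basic
import Mathlib.Algebra.Order.BigOperators.Ring.Finset

/-!
# Representations of the twisted group algebra `ℂ_F[(ℤ/2)ⁿ]` from a Clifford family (DEQ-A118 support, part 1/3)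

HONEST FRAMING: instance-level adjudication of specific advantage claims; no claim about
BQP vs BPP or the summit.

Context: cell pub-qadeq, CLAIMS row A-118 (Muchane arXiv:2607.10473v1), adjudication
`pub-qadeq-deq-1/DEQ-A118.md`; this is part 1 of the Lean proof of its Theorem A118-A
(`CliffordNormCeiling.sum_norm_sq_twConv_le_ceil`), filed by the cell lead (harvest-1 gen 14).

§1. Any family `γ₁, …, γₙ` of pairwise anticommuting elements of a `ℂ`-algebra `R` with `γᵢ² = qᵢ`
extends — by the universal property of Mathlib's `CliffordAlgebra` (`famLift`) composed with the
Albuquerque–Majid identification `toTwistedEquiv` of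
`Literature.Computability.QuantumAlgorithms.CliffordTwistedConvolution` — to a map
`ρ = rep : ℂ_F[(ℤ/2)ⁿ] → R` which is linear and multiplicative for the twisted product (`rep_mul`),
sends `e_∅ ↦ 1`, `eᵢ ↦ γᵢ` (`rep_one`, `rep_gen`) and satisfies `ρ(e_x)ρ(e_y) = F(x,y)ρ(e_{x⊕y})`
(`rep_blade_mul`); if `U` anticommutes with the `γᵢ`, `i ∈ S`, and commutes with the others then
`U ρ(e_x) = (−1)^{#(supp x ∩ S)} ρ(e_x) U` (`conj_sign`, induction on the support of `x`).
§2. Elementary matrix facts used by part 3: if `U² = ε·1`, `ε ≠ 0`, and `UM = −MU` then `tr M = 0`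
(`trace_eq_zero_of_anticomm`); `Σ_{i,j}|T_{ij}|² = tr(T†T)` (`sum_norm_sq_eq_trace`); Frobenius
submultiplicativity `‖AB‖_F² ≤ ‖A‖_F²‖B‖_F²` by Cauchy–Schwarz (`sum_norm_sq_mul_le`); unit scalars
times unitaries are unitary (`smul_mem_unitaryGroup`).  No `sorry`, no named fact; `famLift` and
`rep` are proof scaffolding (definitions with bodies).
-/

noncomputable section

open Finset
open Literature.Computability.QuantumAlgorithms.CliffordTwistedConvolution

namespace Summit.QuantumAdvantage.Dequantization.CliffordFamilyRep

variable {n : ℕ}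

/-! ### 1. Representations of the twisted group algebra from a Clifford family -/

section Family

variable {R : Type*} [Ring R] [Algebra ℂ R] (q : Fin n → ℂ) (γ : Fin n → R)

/-- If the `γᵢ` pairwise anticommute and `γᵢ² = qᵢ`, then `(Σᵢ vᵢγᵢ)² = (Σᵢ qᵢvᵢ²)·1`. -/
theorem linComb_mul_self (hanti : ∀ i j, i ≠ j → γ i * γ j + γ j * γ i = 0)
    (hsq : ∀ i, γ i * γ i = algebraMap ℂ R (q i)) (v : Fin n → ℂ) :
    Fintype.linearCombination ℂ γ v * Fintype.linearCombination ℂ γ v =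
      algebraMap ℂ R (QuadraticMap.weightedSumSquares ℂ q v) := by
  rw [Fintype.linearCombination_apply, QuadraticMap.weightedSumSquares_apply, Finset.sum_mul_sum,
    map_sum]
  rw [← Finset.sum_product' (f := fun i j => (v i • γ i) * (v j • γ j)),
    ← Finset.diag_union_offDiag, Finset.sum_union (Finset.disjoint_diag_offDiag _), Finset.sum_diag]
  have hoff : ∑ ij ∈ (univ : Finset (Fin n)).offDiag, (v ij.1 • γ ij.1) * (v ij.2 • γ ij.2) = 0 := by
    refine Finset.sum_involution (fun ij _ => (ij.2, ij.1)) ?_ ?_ ?_ ?_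
    · intro ij hij
      have hne : ij.1 ≠ ij.2 := (Finset.mem_offDiag.mp hij).2.2
      rw [smul_mul_smul_comm, smul_mul_smul_comm, mul_comm (v ij.2) (v ij.1), ← smul_add,
        hanti _ _ hne, smul_zero]
    · intro ij hij _ h
      exact (Finset.mem_offDiag.mp hij).2.2 (Prod.ext_iff.mp h).2
    · intro ij hij
      simp only [Finset.mem_offDiag, Finset.mem_univ, true_and] at hij ⊢
      exact Ne.symm hij
    · intro ij _
      rfl
  rw [hoff, add_zero]
  refine Finset.sum_congr rfl fun i _ => ?_
  rw [smul_mul_smul_comm, hsq i, Algebra.algebraMap_eq_smul_one, Algebra.algebraMap_eq_smul_one,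
    smul_smul, smul_eq_mul]
  ring_nf

/-- The algebra map `C(V, q) → R` determined by a Clifford family (universal property). -/
def famLift (hanti : ∀ i j, i ≠ j → γ i * γ j + γ j * γ i = 0)
    (hsq : ∀ i, γ i * γ i = algebraMap ℂ R (q i)) :
    CliffordAlgebra (QuadraticMap.weightedSumSquares ℂ q) →ₐ[ℂ] R :=
  CliffordAlgebra.lift _ ⟨Fintype.linearCombination ℂ γ, linComb_mul_self q γ hanti hsq⟩

/-- The representation of the twisted group algebra `ℂ_F[(ℤ/2)ⁿ]` on `R` determined by a Clifford
family: `ρ(a) = lift(φ⁻¹ a)` through the Albuquerque–Majid identification `φ = toTwistedEquiv`. -/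
def rep (hanti : ∀ i j, i ≠ j → γ i * γ j + γ j * γ i = 0)
    (hsq : ∀ i, γ i * γ i = algebraMap ℂ R (q i)) (a : MV n ℂ) : R :=
  famLift q γ hanti hsq ((toTwistedEquiv q).symm a)

variable (hanti : ∀ i j, i ≠ j → γ i * γ j + γ j * γ i = 0)
  (hsq : ∀ i, γ i * γ i = algebraMap ℂ R (q i))

/-- `ρ` is additive. -/
theorem rep_add (a b : MV n ℂ) : rep q γ hanti hsq (a + b) = rep q γ hanti hsq a + rep q γ hanti hsq b := by
  simp only [rep, map_add]

/-- `ρ` is homogeneous. -/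
theorem rep_smul (c : ℂ) (a : MV n ℂ) : rep q γ hanti hsq (c • a) = c • rep q γ hanti hsq a := by
  simp only [rep, map_smul]

/-- `ρ` commutes with finite sums. -/
theorem rep_sum {ι : Type*} (s : Finset ι) (f : ι → MV n ℂ) :
    rep q γ hanti hsq (∑ i ∈ s, f i) = ∑ i ∈ s, rep q γ hanti hsq (f i) := by
  simp only [rep, map_sum]

/-- `ρ` is multiplicative for the twisted product. -/
theorem rep_mul (a b : MV n ℂ) :
    rep q γ hanti hsq (gp q a b) = rep q γ hanti hsq a * rep q γ hanti hsq b := by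
  simp only [rep, ← toTwistedEquiv_symm_mul, map_mul]

/-- `ρ(e_∅) = 1`. -/
theorem rep_one : rep q γ hanti hsq (bladeVec ℂ 0) = 1 := by
  have h : (toTwistedEquiv q).symm (bladeVec ℂ (0 : Blade n)) = 1 := by
    apply (toTwistedEquiv q).injective
    rw [LinearEquiv.apply_symm_apply, toTwistedEquiv_apply, toTwisted_one]
  simp only [rep, h, map_one]

/-- `ρ(eᵢ) = γᵢ`. -/
theorem rep_gen (i : Fin n) : rep q γ hanti hsq (bladeVec ℂ (gen i)) = γ i := by
  have h : (toTwistedEquiv q).symm (bladeVec ℂ (gen i)) = CliffordAlgebra.ι _ (Pi.single i 1) := by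
    apply (toTwistedEquiv q).injective
    rw [LinearEquiv.apply_symm_apply, toTwistedEquiv_apply, toTwisted_ι_single]
  simp only [rep, h, famLift, CliffordAlgebra.lift_ι_apply, Fintype.linearCombination_apply_single,
    one_smul]

/-- `ρ(e_x) ρ(e_y) = F(x,y) ρ(e_{x⊕y})`. -/
theorem rep_blade_mul (x y : Blade n) :
    rep q γ hanti hsq (bladeVec ℂ x) * rep q γ hanti hsq (bladeVec ℂ y) =
      twist q x y • rep q γ hanti hsq (bladeVec ℂ (x + y)) := by
  rw [← rep_mul, gp_bladeVec_bladeVec, rep_smul]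

/-- A multivector is the sum of its blade components. -/
theorem eq_sum_bladeVec (a : MV n ℂ) : a = ∑ x : Blade n, a x • bladeVec ℂ x := by
  funext z
  simp only [Finset.sum_apply, Pi.smul_apply, bladeVec, smul_eq_mul, mul_ite, mul_one, mul_zero,
    Finset.sum_ite_eq, Finset.mem_univ, if_true]

/-- `ρ(a) = Σ_x a_x ρ(e_x)`. -/
theorem rep_eq_sum (a : MV n ℂ) :
    rep q γ hanti hsq a = ∑ x : Blade n, a x • rep q γ hanti hsq (bladeVec ℂ x) := by
  conv_lhs => rw [eq_sum_bladeVec a]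
  rw [rep_sum]
  simp only [rep_smul]

/-- Peeling a generator: for `xᵢ = 1`, `ρ(e_x) = χ_ex(x⊕δᵢ, δᵢ) ρ(e_{x⊕δᵢ}) γᵢ`. -/
theorem rep_blade_peel (x : Blade n) {i : Fin n} (hi : x i = true) :
    rep q γ hanti hsq (bladeVec ℂ x) =
      exchSign ℂ (x + gen i) (gen i) • (rep q γ hanti hsq (bladeVec ℂ (x + gen i)) * γ i) := by
  rw [bladeVec_eq_smul_gp q x hi, rep_smul, rep_mul, rep_gen]

/-- **Conjugation signs.** If `U` anticommutes with the `γᵢ`, `i ∈ S`, and commutes with the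
others, then `U ρ(e_x) = (−1)^{#(supp x ∩ S)} ρ(e_x) U`. -/
theorem conj_sign (U : R) (S : Finset (Fin n)) (hS : ∀ i ∈ S, U * γ i = -(γ i * U))
    (hS' : ∀ i ∉ S, U * γ i = γ i * U) (x : Blade n) :
    U * rep q γ hanti hsq (bladeVec ℂ x) =
      ((-1 : ℂ) ^ (univ.filter fun i => x i = true ∧ i ∈ S).card) •
        (rep q γ hanti hsq (bladeVec ℂ x) * U) := by
  suffices h : ∀ (m : ℕ) (x : Blade n), (univ.filter fun i => x i = true).card = m →
      U * rep q γ hanti hsq (bladeVec ℂ x) =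
        ((-1 : ℂ) ^ (univ.filter fun i => x i = true ∧ i ∈ S).card) •
          (rep q γ hanti hsq (bladeVec ℂ x) * U) from h _ x rfl
  intro m
  induction m with
  | zero =>
      intro x hx
      have hx0 : x = 0 := by
        funext i
        have : i ∉ univ.filter fun i => x i = true := by
          rw [Finset.card_eq_zero] at hx; rw [hx]; exact Finset.notMem_empty i
        simpa using this
      subst hx0
      have he : (univ.filter fun i : Fin n => (0 : Blade n) i = true ∧ i ∈ S) = ∅ := by
        ext i; simp
      rw [he, Finset.card_empty, pow_zero, one_smul, rep_one, mul_one, one_mul]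
  | succ m ih =>
      intro x hx
      obtain ⟨i, hi⟩ : ∃ i, i ∈ univ.filter fun i => x i = true := by
        apply Finset.Nonempty.exists_mem
        rw [← Finset.card_pos, hx]; exact Nat.succ_pos m
      have hxi : x i = true := by simpa using hi
      have hset : (univ.filter fun j => (x + gen i) j = true) =
          (univ.filter fun j => x j = true).erase i := by
        ext j
        by_cases hj : j = i
        · subst hj; simp [hxi, gen]
        · simp [gen, hj]
      have hcard : (univ.filter fun j => (x + gen i) j = true).card = m := by
        rw [hset, Finset.card_erase_of_mem hi, hx]; rfl
      have ih' := ih (x + gen i) hcard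
      -- the sign sets
      have hsetS : (univ.filter fun j => x j = true ∧ j ∈ S) =
          if i ∈ S then insert i (univ.filter fun j => (x + gen i) j = true ∧ j ∈ S)
          else (univ.filter fun j => (x + gen i) j = true ∧ j ∈ S) := by
        split_ifs with hiS
        · ext j
          by_cases hj : j = i
          · subst hj; simp [hxi, hiS]
          · simp [gen, hj]
        · ext j
          by_cases hj : j = i
          · subst hj; simp [hxi, hiS, gen]
          · simp [gen, hj]
      have hnot : i ∉ (univ.filter fun j => (x + gen i) j = true ∧ j ∈ S) := by
        simp [gen, hxi]
      rw [rep_blade_peel q γ hanti hsq x hxi, mul_smul_comm, ← mul_assoc, ih', smul_mul_assoc,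
        mul_assoc, smul_mul_assoc, mul_assoc]
      by_cases hiS : i ∈ S
      · rw [hS i hiS, hsetS, if_pos hiS, Finset.card_insert_of_notMem hnot, pow_succ, mul_neg, smul_neg,
          smul_neg]
        module
      · rw [hS' i hiS, hsetS, if_neg hiS]
        module

end Family

/-! ### 2. Matrix generalities: the trace trick and the Frobenius (Hilbert–Schmidt) norm -/

section MatrixFacts

variable {m : Type*} [Fintype m] [DecidableEq m]

/-- If `U² = ε ≠ 0` and `U` anticommutes with `M`, then `tr M = 0`. -/
theorem trace_eq_zero_of_anticomm {U M : Matrix m m ℂ} {ε : ℂ} (hε : ε ≠ 0)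
    (hU : U * U = ε • (1 : Matrix m m ℂ)) (h : U * M = -(M * U)) : M.trace = 0 := by
  have h1 : (U * M * U).trace = ε * M.trace := by
    rw [Matrix.trace_mul_cycle, hU, smul_mul_assoc, one_mul, Matrix.trace_smul, smul_eq_mul]
  have h2 : (U * M * U).trace = -(ε * M.trace) := by
    rw [h, neg_mul, Matrix.trace_neg, mul_assoc, hU, mul_smul_comm, mul_one, Matrix.trace_smul,
      smul_eq_mul]
  have h3 : ε * M.trace = 0 := by linear_combination (1 / 2 : ℂ) * (h1.symm.trans h2)
  exact (mul_eq_zero.mp h3).resolve_left hε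

omit [DecidableEq m] in
/-- `Σ_{i,j} |T i j|² = tr(T† T)`. -/
theorem sum_norm_sq_eq_trace (T : Matrix m m ℂ) :
    (((∑ i, ∑ j, ‖T i j‖ ^ 2 : ℝ)) : ℂ) = (star T * T).trace := by
  rw [Matrix.trace, Finset.sum_comm]
  push_cast
  refine Finset.sum_congr rfl fun j _ => ?_
  rw [Matrix.diag_apply, Matrix.mul_apply]
  refine Finset.sum_congr rfl fun i _ => ?_
  rw [Matrix.star_apply, RCLike.star_def, Complex.conj_mul']

omit [DecidableEq m] in
/-- Submultiplicativity of the Frobenius norm (Cauchy–Schwarz): `‖AB‖_F² ≤ ‖A‖_F² ‖B‖_F²`. -/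
theorem sum_norm_sq_mul_le (A B : Matrix m m ℂ) :
    ∑ i, ∑ j, ‖(A * B) i j‖ ^ 2 ≤ (∑ i, ∑ l, ‖A i l‖ ^ 2) * ∑ l, ∑ j, ‖B l j‖ ^ 2 := by
  have hB : (∑ l, ∑ j, ‖B l j‖ ^ 2) = ∑ j, ∑ l, ‖B l j‖ ^ 2 := Finset.sum_comm
  rw [hB, Finset.sum_mul_sum]
  refine Finset.sum_le_sum fun i _ => Finset.sum_le_sum fun j _ => ?_
  rw [Matrix.mul_apply]
  calc ‖∑ l, A i l * B l j‖ ^ 2 ≤ (∑ l, ‖A i l‖ * ‖B l j‖) ^ 2 := by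
        gcongr
        exact (norm_sum_le _ _).trans (le_of_eq (Finset.sum_congr rfl fun l _ => norm_mul _ _))
    _ ≤ (∑ l, ‖A i l‖ ^ 2) * ∑ l, ‖B l j‖ ^ 2 := Finset.sum_mul_sq_le_sq_mul_sq _ _ _

/-- Unit scalars times unitaries are unitary. -/
theorem smul_mem_unitaryGroup {c : ℂ} (hc : star c * c = 1) {U : Matrix m m ℂ}
    (hU : U ∈ Matrix.unitaryGroup m ℂ) : c • U ∈ Matrix.unitaryGroup m ℂ := by
  rw [Matrix.mem_unitaryGroup_iff'] at hU ⊢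
  rw [star_smul, smul_mul_smul_comm, hc, hU, one_smul]

end MatrixFacts

end Summit.QuantumAdvantage.Dequantization.CliffordFamilyRep
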